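import Literature.MathematicalPhysics.QuantumFieldTheory.TorusOddRP
import HarnessLib

/-!
# Log-convexity of rectangular Wilson loops on the odd torus

For the torus Wilson state on the odd torus `(ℤ/Lℤ)^d`, `L = 2n + 1` (`β ≥ 0`, continuous matrix
representation `ρ` of the compact gauge group `G`), this file proves the four
reflection-positivity inequalities for rectangular Wilson loops `W(h, m) = ⟨W_{h×m}⟩_{Λ,β}` in
the `(0, j)` plane that on even tori are `TorusLoopLinkRP` / `TorusSiteRP`:

* `wilsonExpectation_wilsonLoop_nonneg_of_odd_oddTorus`, `…_sq_le_of_link_oddTorus` — loops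
  cut by the hyperplane `t = ½` between lattice planes (odd heights);
* `wilsonExpectation_wilsonLoop_nonneg_of_even_oddTorus`, `…_sq_le_of_site_oddTorus` — loops cut
  by the lattice hyperplane `t = n + 1` (even heights).

Both come from the single reflection `θ t = 1 - t` (`GaugeConfig.timeReflect`), which on the
odd torus is of the mixed type treated in `TorusOddRP` (crossing links at `t = 0 → 1`, shared
spatial links at `t = n + 1`): after the splitting `V = tL(Y, U)` of the crossing links, the
weighted loop `e^{-βS(V)} W(V)` is `e^{-βN#plaq} N⁻¹ Re ∑_{kl} Φ_{kl}(z) conj Ψ_{kl}(ΘU) K(U, Y)`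
with `K` the crossing Gram kernel and `Φ, Ψ` the entries of the unitarised (extended, resp.
downward) staples times `e^{β(A + A_M/2)}` (`weight_mul_wilsonLoop_link_odd`,
`weight_mul_wilsonLoop_site_odd`); the generic steps — splitting of the crossing links by Haar
invariance, passage to the product integral, Cauchy–Schwarz of the abstract mechanism
(`LatticeRP.re_sum_pair_sq_le`) — are isolated in `oddIntegral_eq_re_sum_pair` and
`oddIntegral_sq_le`. These inequalities complete, for all torus sizes, the input of
`StringTension.hasStringTension_of_eventually` (named fact `exists_hasStringTension`).
Everything here is proved; no definitions.

## References

* K. Osterwalder, E. Seiler, Ann. Phys. 110 (1978) 440, §2; E. Seiler, LNP 159 (1982), §2.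
* C. Borgs, E. Seiler, Commun. Math. Phys. 91 (1983) 329, §II.2.
-/

noncomputable section

open MeasureTheory Finset Complex
open scoped ComplexOrder ComplexConjugate

namespace Literature.MathematicalPhysics.QuantumFieldTheory

namespace StringTension

open WilsonRP LatticeRP Literature.RepresentationTheory.CompactGroups

variable {d L N : ℕ} [NeZero d] [NeZero L] [Fact (1 < L)]
variable {G : Type*} [Group G] [TopologicalSpace G] [IsTopologicalGroup G] [CompactSpace G]
  [MeasurableSpace G] [BorelSpace G]
variable (ρ : G →* Matrix (Fin N) (Fin N) ℂ)

/-! ### The generic steps: splitting, product integral, Cauchy–Schwarz -/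

section Generic

omit [Fact (1 < L)] in
/-- **From the pointwise identity after the splitting to the weighted loop integral.** If for
all `U, Y` the weighted observable at `V = tL(Y, U)` equals
`κ Re ∑_{kl} Φ_{kl}(splice_C(U, Y)) conj Ψ_{kl}(ΘU) K(U, Y)` (`K` the crossing Gram kernel of
the odd torus), then `∫ e^{-βS} w ∏dU = κ Re ∑_{kl} ∫∫ Φ_{kl}(z) conj Ψ_{kl}(ΘU) K dU dY`
(Haar invariance of the splitting, Fubini). [folklore] -/
theorem oddIntegral_eq_re_sum_pair (hρ : Continuous ρ) (β : ℝ) {κ : ℝ}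
    {Φ Ψ : Fin N × Fin N → GaugeConfig d L G → ℂ}
    (hΦm : ∀ kl, Measurable (Φ kl)) (hΨm : ∀ kl, Measurable (Ψ kl)) {KΦ KΨ : ℝ}
    (hΦb : ∀ kl U, ‖Φ kl U‖ ≤ KΦ) (hΨb : ∀ kl U, ‖Ψ kl U‖ ≤ KΨ)
    (w : GaugeConfig d L G → ℝ) (hwm : Measurable w)
    (hpt : ∀ U Y : GaugeConfig d L G,
      Real.exp (-β * wilsonAction ρ (fun e' : Edge d L =>
          U e' * (if Prod.snd e' = 0 ∧ ZMod.val (Prod.fst e' 0) = 0 then Y e' else 1))) *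
        w (fun e' : Edge d L =>
          U e' * (if Prod.snd e' = 0 ∧ ZMod.val (Prod.fst e' 0) = 0 then Y e' else 1)) =
      κ * (∑ kl : Fin N × Fin N,
        Φ kl (LatticeRP.splice (Finset.univ.filter fun e : Edge d L =>
          Prod.snd e = 0 ∧ ZMod.val (Prod.fst e 0) = 0) (U, Y)) * conj (Ψ kl U.timeReflect) *
        Complex.exp (∑ i : CoeffIndex d L N,
          (fun (i : CoeffIndex d L N) (V : GaugeConfig d L G) =>
            if Prod.fst (Subtype.val (Prod.snd (Prod.fst i))) = 0 ∧ ZMod.val (Prod.fst (Prod.fst i) 0) = 0 then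
              (Real.sqrt (β / 2) : ℂ) *
                (if i.2.2.2 then CompactGroup.unitarize ρ hρ (halfPlaq i.1 V) i.2.1 i.2.2.1
                  else conj (CompactGroup.unitarize ρ hρ (halfPlaq i.1 V) i.2.1 i.2.2.1))
            else 0) i (LatticeRP.splice (Finset.univ.filter fun e : Edge d L =>
              Prod.snd e = 0 ∧ ZMod.val (Prod.fst e 0) = 0) (U, Y)) *
          conj ((fun (i : CoeffIndex d L N) (V : GaugeConfig d L G) =>
            if Prod.fst (Subtype.val (Prod.snd (Prod.fst i))) = 0 ∧ ZMod.val (Prod.fst (Prod.fst i) 0) = 0 then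
              (Real.sqrt (β / 2) : ℂ) *
                (if i.2.2.2 then CompactGroup.unitarize ρ hρ (halfPlaq i.1 V) i.2.1 i.2.2.1
                  else conj (CompactGroup.unitarize ρ hρ (halfPlaq i.1 V) i.2.1 i.2.2.1))
            else 0) i U.timeReflect))).re) :
    ∫ U, Real.exp (-β * wilsonAction ρ U) * w U ∂(LatticeRP.piMeasure (haarProbability G)) =
      κ * (∑ kl : Fin N × Fin N, ∫ pp,
        Φ kl (LatticeRP.splice (Finset.univ.filter fun e : Edge d L =>
          Prod.snd e = 0 ∧ ZMod.val (Prod.fst e 0) = 0) pp) * conj (Ψ kl (GaugeConfig.timeReflect pp.1)) *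
        Complex.exp (∑ i : CoeffIndex d L N,
          (fun (i : CoeffIndex d L N) (V : GaugeConfig d L G) =>
            if Prod.fst (Subtype.val (Prod.snd (Prod.fst i))) = 0 ∧ ZMod.val (Prod.fst (Prod.fst i) 0) = 0 then
              (Real.sqrt (β / 2) : ℂ) *
                (if i.2.2.2 then CompactGroup.unitarize ρ hρ (halfPlaq i.1 V) i.2.1 i.2.2.1
                  else conj (CompactGroup.unitarize ρ hρ (halfPlaq i.1 V) i.2.1 i.2.2.1))
            else 0) i (LatticeRP.splice (Finset.univ.filter fun e : Edge d L =>
              Prod.snd e = 0 ∧ ZMod.val (Prod.fst e 0) = 0) pp) *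
          conj ((fun (i : CoeffIndex d L N) (V : GaugeConfig d L G) =>
            if Prod.fst (Subtype.val (Prod.snd (Prod.fst i))) = 0 ∧ ZMod.val (Prod.fst (Prod.fst i) 0) = 0 then
              (Real.sqrt (β / 2) : ℂ) *
                (if i.2.2.2 then CompactGroup.unitarize ρ hρ (halfPlaq i.1 V) i.2.1 i.2.2.1
                  else conj (CompactGroup.unitarize ρ hρ (halfPlaq i.1 V) i.2.1 i.2.2.1))
            else 0) i (GaugeConfig.timeReflect pp.1)))
        ∂((LatticeRP.piMeasure (haarProbability G)).prod (LatticeRP.piMeasure (haarProbability G)))).re := by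
  set μH : Measure (GaugeConfig d L G) := LatticeRP.piMeasure (haarProbability G) with hμH
  set a : CoeffIndex d L N → GaugeConfig d L G → ℂ := fun (i : CoeffIndex d L N) (V : GaugeConfig d L G) =>
    if Prod.fst (Subtype.val (Prod.snd (Prod.fst i))) = 0 ∧ ZMod.val (Prod.fst (Prod.fst i) 0) = 0 then
      (Real.sqrt (β / 2) : ℂ) *
        (if i.2.2.2 then CompactGroup.unitarize ρ hρ (halfPlaq i.1 V) i.2.1 i.2.2.1
          else conj (CompactGroup.unitarize ρ hρ (halfPlaq i.1 V) i.2.1 i.2.2.1))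
    else 0 with ha
  set C : Finset (Edge d L) := Finset.univ.filter fun e : Edge d L =>
    Prod.snd e = 0 ∧ ZMod.val (Prod.fst e 0) = 0 with hC
  have ham : ∀ i, Measurable (a i) := fun i => measurable_coeffLower ρ hρ β i
  have hab : ∀ i U, ‖a i U‖ ≤ Real.sqrt (β / 2) := fun i U => norm_coeffLower_le ρ hρ β i U
  -- the doubled integrand
  set S : GaugeConfig d L G × GaugeConfig d L G → ℂ := fun pp => ∑ kl : Fin N × Fin N,
    Φ kl (splice C pp) * conj (Ψ kl (GaugeConfig.timeReflect pp.1)) *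
      Complex.exp (∑ i, a i (splice C pp) * conj (a i (GaugeConfig.timeReflect pp.1))) with hS
  have hSi' : ∀ kl, Integrable (fun pp : GaugeConfig d L G × GaugeConfig d L G =>
      Φ kl (splice C pp) * conj (Ψ kl (GaugeConfig.timeReflect pp.1)) *
        Complex.exp (∑ i, a i (splice C pp) * conj (a i (GaugeConfig.timeReflect pp.1)))) (μH.prod μH) :=
    fun kl => integrable_pairIntegrand (haarProbability G) C GaugeConfig.timeReflect a
      measurable_timeReflect (hΦm kl) (hΨm kl) ham (hΦb kl) (hΨb kl) hab
  have hSi : Integrable S (μH.prod μH) := by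
    simpa only [hS] using integrable_finsetSum _ fun kl _ => hSi' kl
  -- the weighted observable
  set F : GaugeConfig d L G → ℝ := fun U => Real.exp (-β * wilsonAction ρ U) * w U with hF
  have hFm : Measurable F := (((WilsonRP.measurable_wilsonAction ρ hρ).const_mul (-β)).exp).mul hwm
  have hpt' : ∀ U Y, F (fun e' : Edge d L =>
      U e' * (if Prod.snd e' = 0 ∧ ZMod.val (Prod.fst e' 0) = 0 then Y e' else 1)) = κ * (S (U, Y)).re :=
    fun U Y => hpt U Y
  -- Step 1: split the crossing links for every `Y`
  have step1 : ∀ Y, ∫ U, F U ∂μH = ∫ U, κ * (S (U, Y)).re ∂μH := by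
    intro Y
    have h1 : ∫ U, F (fun e' : Edge d L =>
        U e' * (if Prod.snd e' = 0 ∧ ZMod.val (Prod.fst e' 0) = 0 then Y e' else 1)) ∂μH = ∫ U, F U ∂μH := by
      rw [← integral_map (measurePreserving_translateLower Y).measurable.aemeasurable
        hFm.aestronglyMeasurable, (measurePreserving_translateLower Y).map_eq]
    rw [← h1]
    exact integral_congr_ae (ae_of_all _ fun U => hpt' U Y)
  -- Step 2: integrate over `Y` and pass to the product
  have hDi : Integrable (fun pp : GaugeConfig d L G × GaugeConfig d L G => κ * (S pp).re) (μH.prod μH) :=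
    hSi.re.const_mul κ
  have step2 : ∫ U, F U ∂μH = ∫ pp, κ * (S pp).re ∂(μH.prod μH) := by
    calc ∫ U, F U ∂μH = ∫ _Y, (∫ U, F U ∂μH) ∂μH := by rw [integral_const, probReal_univ, one_smul]
      _ = ∫ Y, ∫ U, κ * (S (U, Y)).re ∂μH ∂μH := integral_congr_ae (ae_of_all _ step1)
      _ = ∫ pp, κ * (S pp).re ∂(μH.prod μH) := (integral_prod_symm _ hDi).symm
  rw [step2, integral_const_mul]
  congr 1
  have hre := integral_re hSi
  simp only [RCLike.re_to_complex] at hre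
  rw [hre, hS, integral_finsetSum _ fun kl _ => hSi' kl]

/-- **Cauchy–Schwarz for three weighted observables on the odd torus.** Let `Φ, Ψ` be families
of bounded measurable functions depending only on `P ∪ C ∪ M`, and let the weighted observables
`w₁₂, w₁₁, w₂₂` satisfy the pointwise splitting identities with `(Φ, Ψ)`, `(Φ, Φ)`, `(Ψ, Ψ)` and
a common constant `κ ≥ 0`. Then `0 ≤ ∫ e^{-βS} w₁₁` and
`(∫ e^{-βS} w₁₂)² ≤ (∫ e^{-βS} w₁₁) (∫ e^{-βS} w₂₂)` (the abstract reflection positivity of the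
mixed reflection on the odd torus, `LatticeRP.re_sum_pair_sq_le`). [folklore] -/
theorem oddIntegral_sq_le (hL : Odd L) (hρ : Continuous ρ) (β : ℝ) {κ : ℝ} (hκ : 0 ≤ κ)
    {Φ Ψ : Fin N × Fin N → GaugeConfig d L G → ℂ}
    (hΦm : ∀ kl, Measurable (Φ kl)) (hΨm : ∀ kl, Measurable (Ψ kl)) {KΦ KΨ : ℝ}
    (hΦb : ∀ kl U, ‖Φ kl U‖ ≤ KΦ) (hΨb : ∀ kl U, ‖Ψ kl U‖ ≤ KΨ)
    (hΦd : ∀ kl, DependsOn (Φ kl) (((Finset.univ.filter fun e : Edge d L =>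
        1 ≤ ZMod.val (Prod.fst e 0) ∧ ZMod.val (Prod.fst e 0) ≤ L / 2) ∪
      (Finset.univ.filter fun e : Edge d L => Prod.snd e = 0 ∧ ZMod.val (Prod.fst e 0) = 0) ∪
      (Finset.univ.filter fun e : Edge d L =>
        Prod.snd e ≠ 0 ∧ ZMod.val (Prod.fst e 0) = L / 2 + 1) : Finset (Edge d L)) : Set (Edge d L)))
    (hΨd : ∀ kl, DependsOn (Ψ kl) (((Finset.univ.filter fun e : Edge d L =>
        1 ≤ ZMod.val (Prod.fst e 0) ∧ ZMod.val (Prod.fst e 0) ≤ L / 2) ∪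
      (Finset.univ.filter fun e : Edge d L => Prod.snd e = 0 ∧ ZMod.val (Prod.fst e 0) = 0) ∪
      (Finset.univ.filter fun e : Edge d L =>
        Prod.snd e ≠ 0 ∧ ZMod.val (Prod.fst e 0) = L / 2 + 1) : Finset (Edge d L)) : Set (Edge d L)))
    (w₁₂ w₁₁ w₂₂ : GaugeConfig d L G → ℝ) (h₁₂m : Measurable w₁₂) (h₁₁m : Measurable w₁₁)
    (h₂₂m : Measurable w₂₂)
    (hpt : ∀ (ΦΨ : (Fin N × Fin N → GaugeConfig d L G → ℂ) × (Fin N × Fin N → GaugeConfig d L G → ℂ) ×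
        (GaugeConfig d L G → ℝ)),
      ΦΨ ∈ [(Φ, Ψ, w₁₂), (Φ, Φ, w₁₁), (Ψ, Ψ, w₂₂)] → ∀ U Y : GaugeConfig d L G,
      Real.exp (-β * wilsonAction ρ (fun e' : Edge d L =>
          U e' * (if Prod.snd e' = 0 ∧ ZMod.val (Prod.fst e' 0) = 0 then Y e' else 1))) *
        ΦΨ.2.2 (fun e' : Edge d L =>
          U e' * (if Prod.snd e' = 0 ∧ ZMod.val (Prod.fst e' 0) = 0 then Y e' else 1)) =
      κ * (∑ kl : Fin N × Fin N,
        ΦΨ.1 kl (LatticeRP.splice (Finset.univ.filter fun e : Edge d L =>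
          Prod.snd e = 0 ∧ ZMod.val (Prod.fst e 0) = 0) (U, Y)) * conj (ΦΨ.2.1 kl U.timeReflect) *
        Complex.exp (∑ i : CoeffIndex d L N,
          (fun (i : CoeffIndex d L N) (V : GaugeConfig d L G) =>
            if Prod.fst (Subtype.val (Prod.snd (Prod.fst i))) = 0 ∧ ZMod.val (Prod.fst (Prod.fst i) 0) = 0 then
              (Real.sqrt (β / 2) : ℂ) *
                (if i.2.2.2 then CompactGroup.unitarize ρ hρ (halfPlaq i.1 V) i.2.1 i.2.2.1
                  else conj (CompactGroup.unitarize ρ hρ (halfPlaq i.1 V) i.2.1 i.2.2.1))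
            else 0) i (LatticeRP.splice (Finset.univ.filter fun e : Edge d L =>
              Prod.snd e = 0 ∧ ZMod.val (Prod.fst e 0) = 0) (U, Y)) *
          conj ((fun (i : CoeffIndex d L N) (V : GaugeConfig d L G) =>
            if Prod.fst (Subtype.val (Prod.snd (Prod.fst i))) = 0 ∧ ZMod.val (Prod.fst (Prod.fst i) 0) = 0 then
              (Real.sqrt (β / 2) : ℂ) *
                (if i.2.2.2 then CompactGroup.unitarize ρ hρ (halfPlaq i.1 V) i.2.1 i.2.2.1
                  else conj (CompactGroup.unitarize ρ hρ (halfPlaq i.1 V) i.2.1 i.2.2.1))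
            else 0) i U.timeReflect))).re) :
    0 ≤ ∫ U, Real.exp (-β * wilsonAction ρ U) * w₁₁ U ∂(LatticeRP.piMeasure (haarProbability G)) ∧
    (∫ U, Real.exp (-β * wilsonAction ρ U) * w₁₂ U ∂(LatticeRP.piMeasure (haarProbability G))) ^ 2 ≤
      (∫ U, Real.exp (-β * wilsonAction ρ U) * w₁₁ U ∂(LatticeRP.piMeasure (haarProbability G))) *
      (∫ U, Real.exp (-β * wilsonAction ρ U) * w₂₂ U ∂(LatticeRP.piMeasure (haarProbability G))) := by
  have e12 := oddIntegral_eq_re_sum_pair ρ hρ β hΦm hΨm hΦb hΨb w₁₂ h₁₂m (hpt (Φ, Ψ, w₁₂) (by simp))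
  have e11 := oddIntegral_eq_re_sum_pair ρ hρ β hΦm hΦm hΦb hΦb w₁₁ h₁₁m (hpt (Φ, Φ, w₁₁) (by simp))
  have e22 := oddIntegral_eq_re_sum_pair ρ hρ β hΨm hΨm hΨb hΨb w₂₂ h₂₂m (hpt (Ψ, Ψ, w₂₂) (by simp))
  have hCS := re_sum_pair_sq_le (haarProbability G)
    (Finset.univ.filter fun e : Edge d L => Prod.snd e = 0 ∧ ZMod.val (Prod.fst e 0) = 0)
    (GaugeConfig.timeReflect : GaugeConfig d L G → GaugeConfig d L G)
    (fun (i : CoeffIndex d L N) (V : GaugeConfig d L G) =>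
      if Prod.fst (Subtype.val (Prod.snd (Prod.fst i))) = 0 ∧ ZMod.val (Prod.fst (Prod.fst i) 0) = 0 then
        (Real.sqrt (β / 2) : ℂ) *
          (if i.2.2.2 then CompactGroup.unitarize ρ hρ (halfPlaq i.1 V) i.2.1 i.2.2.1
            else conj (CompactGroup.unitarize ρ hρ (halfPlaq i.1 V) i.2.1 i.2.2.1))
      else 0)
    (Finset.univ.filter fun e : Edge d L => Prod.snd e ≠ 0 ∧ ZMod.val (Prod.fst e 0) = L / 2 + 1)
    (Finset.univ.filter fun e : Edge d L => 1 ≤ ZMod.val (Prod.fst e 0) ∧ ZMod.val (Prod.fst e 0) ≤ L / 2)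
    measurePreserving_timeReflect (fun U e he => timeReflect_apply_of_mem_M_odd hL U e he)
    (fun e he => dependsOn_timeReflect_apply_odd hL e he) disjoint_M_P_odd disjoint_M_C_odd
    (fun i => measurable_coeffLower ρ hρ β i) (fun i U => norm_coeffLower_le ρ hρ β i U)
    (fun i => dependsOn_coeffLower ρ hρ β i) hΦm hΨm hΦb hΨb hΦd hΨd
  obtain ⟨h0, hsq⟩ := hCS
  rw [e12, e11, e22]
  refine ⟨mul_nonneg hκ h0, ?_⟩
  rw [mul_pow, mul_mul_mul_comm, ← sq]
  exact mul_le_mul_of_nonneg_left hsq (sq_nonneg _)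

end Generic


/-! ### Time coordinates of the staples -/

section Vals

variable {j : Fin d}

omit [NeZero L] [Fact (1 < L)] in
/-- Time coordinate of the inner links of an extended staple above a base point of the slice
`0`: `s + 1`. [folklore] -/
theorem val_leg_of_apply_zero {b : Site d L} (hb : b 0 = 0) {s : ℕ} (hs : s + 1 < L) :
    ((b.shift 0 + Pi.single 0 ((s : ℕ) : ZMod L) : Site d L) 0).val = s + 1 := by
  rw [Pi.add_apply, Pi.single_eq_same, WilsonRP.shift_apply_self, hb, zero_add,
    show (1 : ZMod L) + ((s : ℕ) : ZMod L) = (((s + 1 : ℕ)) : ZMod L) by push_cast; ring,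
    ZMod.val_cast_of_lt hs]

omit [NeZero L] [Fact (1 < L)] in
/-- Time coordinate of the top of an extended staple: `h + 1`. [folklore] -/
theorem val_top_of_apply_zero {b : Site d L} (hb : b 0 = 0) (hj : j ≠ 0) {h : ℕ} (hh : h + 1 < L)
    (r : ZMod L) :
    ((b + Pi.single 0 (((h + 1 : ℕ)) : ZMod L) + Pi.single j r : Site d L) 0).val = h + 1 := by
  rw [apply_zero_add_single_of_ne _ hj, apply_zero_add_single_zero hb, ZMod.val_cast_of_lt hh]

omit [Fact (1 < L)] in
/-- Time coordinate of the links of the loop below the slice `0`: `L - (q - r)`. [folklore] -/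
theorem val_lower_of_apply_zero {b : Site d L} (hb : b 0 = 0) {q r : ℕ} (hr : r < q) (hq : q < L) :
    ((b + Pi.single 0 (-((q : ℕ) : ZMod L)) + Pi.single 0 ((r : ℕ) : ZMod L) : Site d L) 0).val =
      L - (q - r) := by
  have hcast : (-((q : ℕ) : ZMod L)) + ((r : ℕ) : ZMod L) = -(((q - r : ℕ)) : ZMod L) := by
    rw [Nat.cast_sub hr.le]; ring
  have hne : (((q - r : ℕ)) : ZMod L) ≠ 0 := by
    intro h0
    have := congrArg ZMod.val h0
    rw [ZMod.val_cast_of_lt (by omega), ZMod.val_zero] at this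
    omega
  rw [add_assoc, ← Pi.single_add, apply_zero_add_single_zero hb, hcast, ZMod.neg_val, if_neg hne,
    ZMod.val_cast_of_lt (by omega)]

omit [NeZero L] [Fact (1 < L)] in
/-- `θ(c + t e₀) = c - t e₀` for `c` in the lattice plane of the odd torus (`c₀ + c₀ = 1`).
[folklore] -/
theorem timeReflect_add_single_of_add_self {c : Site d L} (hc : c 0 + c 0 = 1) (t : ZMod L) :
    (c + Pi.single 0 t).timeReflect = c + Pi.single 0 (-t) := by
  funext k
  by_cases hk : k = 0
  · subst hk
    simp only [Site.timeReflect, Function.update_self, Pi.add_apply, Pi.single_eq_same]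
    linear_combination -hc
  · simp [Site.timeReflect, hk]

omit [NeZero L] [Fact (1 < L)] in
/-- `θ(c + t e₀ + e₀) = c - (t + 1) e₀` for `c₀ + c₀ = 1`. [folklore] -/
theorem timeReflect_shift_add_single_of_add_self {c : Site d L} (hc : c 0 + c 0 = 1) (t : ZMod L) :
    ((c + Pi.single 0 t).shift 0).timeReflect = c + Pi.single 0 (-(t + 1)) := by
  have h : (c + Pi.single 0 t).shift 0 = c + Pi.single (0 : Fin d) (t + 1) := by
    simp only [Site.shift, add_assoc, ← Pi.single_add]
  rw [h, timeReflect_add_single_of_add_self hc]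

omit [NeZero L] in
/-- Time coordinate of the points of a downward staple hanging from the plane `t = L/2 + 1` of
the odd torus: `L/2 + 1 - h + s` (`s ≤ h ≤ L/2 + 1`). [folklore] -/
theorem val_downStaple_site_odd (hL : Odd L) (hj : j ≠ 0) {h s : ℕ} (hs : s ≤ h) (hh : h ≤ L / 2 + 1)
    (r : ZMod L) :
    (((0 : Site d L) + Pi.single 0 (((L / 2 + 1 : ℕ)) : ZMod L) + Pi.single 0 (-((h : ℕ) : ZMod L)) +
        Pi.single j r + Pi.single 0 ((s : ℕ) : ZMod L) : Site d L) 0).val = L / 2 + 1 - h + s := by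
  have h1L : 1 < L := Fact.out
  have hO := Nat.odd_iff.mp hL
  simp only [Pi.add_apply, Pi.single_eq_same, Pi.single_eq_of_ne (Ne.symm hj), zero_add, add_zero]
  rw [show (((L / 2 + 1 : ℕ)) : ZMod L) + -((h : ℕ) : ZMod L) + ((s : ℕ) : ZMod L) =
      (((L / 2 + 1 - h + s : ℕ)) : ZMod L) by push_cast [Nat.cast_sub hh]; ring,
    ZMod.val_cast_of_lt (by omega)]

end Vals

/-! ### Extended staples on the odd torus: dependence and the splitting -/

section LinkStaples

variable {j : Fin d}

omit [TopologicalSpace G] [IsTopologicalGroup G] [CompactSpace G] [MeasurableSpace G]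
  [BorelSpace G] in
/-- **The extended staple above a base point `b` of the slice `0` depends only on `P ∪ C ∪ M`**
(`h + 1 ≤ L/2`), odd torus blocks. [folklore] -/
theorem staple_congr_odd {b : Site d L} (hb : b 0 = 0) (hj : j ≠ 0) {h : ℕ} (hh : h + 1 ≤ L / 2)
    (m : ℕ) {V V' : GaugeConfig d L G}
    (hVV' : ∀ e ∈ (((Finset.univ.filter fun e : Edge d L =>
        1 ≤ ZMod.val (Prod.fst e 0) ∧ ZMod.val (Prod.fst e 0) ≤ L / 2) ∪
      (Finset.univ.filter fun e : Edge d L => Prod.snd e = 0 ∧ ZMod.val (Prod.fst e 0) = 0) ∪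
      (Finset.univ.filter fun e : Edge d L =>
        Prod.snd e ≠ 0 ∧ ZMod.val (Prod.fst e 0) = L / 2 + 1) : Finset (Edge d L)) : Set (Edge d L)),
        V e = V' e) :
    lineHolonomy V 0 (h + 1) b * lineHolonomy V j m (b + Pi.single 0 (((h + 1 : ℕ)) : ZMod L)) *
        (lineHolonomy V 0 (h + 1) (b + Pi.single j ((m : ℕ) : ZMod L)))⁻¹ =
      lineHolonomy V' 0 (h + 1) b * lineHolonomy V' j m (b + Pi.single 0 (((h + 1 : ℕ)) : ZMod L)) *
        (lineHolonomy V' 0 (h + 1) (b + Pi.single j ((m : ℕ) : ZMod L)))⁻¹ := by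
  have h1L : 1 < L := Fact.out
  have hL2 : L / 2 < L := Nat.div_lt_self (by omega) one_lt_two
  have hP : ∀ e : Edge d L, 1 ≤ ZMod.val (Prod.fst e 0) ∧ ZMod.val (Prod.fst e 0) ≤ L / 2 → V e = V' e := by
    intro e he
    apply hVV'
    rw [Finset.coe_union, Finset.coe_union, Set.mem_union, Set.mem_union, Finset.mem_coe,
      Finset.mem_filter]
    exact Or.inl (Or.inl ⟨Finset.mem_univ _, he⟩)
  have hC : ∀ e : Edge d L, Prod.snd e = 0 ∧ ZMod.val (Prod.fst e 0) = 0 → V e = V' e := by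
    intro e he
    apply hVV'
    rw [Finset.coe_union, Finset.coe_union, Set.mem_union, Set.mem_union, Finset.mem_coe,
      Finset.mem_coe, Finset.mem_filter, Finset.mem_filter]
    exact Or.inl (Or.inr ⟨Finset.mem_univ _, he⟩)
  have hleg : ∀ b' : Site d L, b' 0 = 0 → lineHolonomy V 0 (h + 1) b' = lineHolonomy V' 0 (h + 1) b' := by
    intro b' hb'
    rw [lineHolonomy_succ, lineHolonomy_succ, hC (b', 0) ⟨rfl, by simp [hb']⟩]
    congr 1
    refine lineHolonomy_congr 0 h _ fun s hs => hP _ ?_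
    simp only [val_leg_of_apply_zero hb' (by omega : s + 1 < L)]
    omega
  have hb' : (b + Pi.single j ((m : ℕ) : ZMod L) : Site d L) 0 = 0 := add_single_apply_zero_of_ne hb hj _
  rw [hleg b hb, hleg _ hb', lineHolonomy_congr j m _ fun r _ => hP _ ?_]
  simp only [val_top_of_apply_zero hb hj (by omega : h + 1 < L)]
  omega

omit [NeZero L] [TopologicalSpace G] [IsTopologicalGroup G] [CompactSpace G] [MeasurableSpace G]
  [BorelSpace G] in
/-- The inner staple (without the crossing links) is unchanged by a change of the configuration
on the crossing links. [folklore] -/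
theorem innerStaple_congr_off_cross {b : Site d L} (hb : b 0 = 0) (hj : j ≠ 0) {h : ℕ}
    (hh : h + 1 ≤ L / 2) (m : ℕ) {V V' : GaugeConfig d L G}
    (hVV' : ∀ e : Edge d L, ¬ (Prod.snd e = 0 ∧ ZMod.val (Prod.fst e 0) = 0) → V e = V' e) :
    lineHolonomy V 0 h (b.shift 0) * lineHolonomy V j m (b + Pi.single 0 (((h + 1 : ℕ)) : ZMod L)) *
        (lineHolonomy V 0 h ((b + Pi.single j ((m : ℕ) : ZMod L)).shift 0))⁻¹ =
      lineHolonomy V' 0 h (b.shift 0) * lineHolonomy V' j m (b + Pi.single 0 (((h + 1 : ℕ)) : ZMod L)) *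
        (lineHolonomy V' 0 h ((b + Pi.single j ((m : ℕ) : ZMod L)).shift 0))⁻¹ := by
  have h1L : 1 < L := Fact.out
  have hL2 : L / 2 < L := Nat.div_lt_self (by omega) one_lt_two
  have hleg : ∀ b' : Site d L, b' 0 = 0 → lineHolonomy V 0 h (b'.shift 0) = lineHolonomy V' 0 h (b'.shift 0) := by
    intro b' hb'
    refine lineHolonomy_congr 0 h _ fun s hs => hVV' _ fun hc => ?_
    rw [val_leg_of_apply_zero hb' (by omega : s + 1 < L)] at hc
    omega
  have hb' : (b + Pi.single j ((m : ℕ) : ZMod L) : Site d L) 0 = 0 := add_single_apply_zero_of_ne hb hj _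
  rw [hleg b hb, hleg _ hb', lineHolonomy_congr j m _ fun r _ => hVV' _ fun hc => hj hc.1]

omit [Fact (1 < L)] [TopologicalSpace G] [IsTopologicalGroup G] [CompactSpace G] [MeasurableSpace G]
  [BorelSpace G] in
/-- The lines of the loop below the slice `0` contain no crossing link (`q < L`). [folklore] -/
theorem lineHolonomy_lower_congr_off_cross {b : Site d L} (hb : b 0 = 0) {q : ℕ} (hq : q < L)
    {V V' : GaugeConfig d L G}
    (hVV' : ∀ e : Edge d L, ¬ (Prod.snd e = 0 ∧ ZMod.val (Prod.fst e 0) = 0) → V e = V' e) :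
    lineHolonomy V 0 q (b + Pi.single 0 (-((q : ℕ) : ZMod L))) =
      lineHolonomy V' 0 q (b + Pi.single 0 (-((q : ℕ) : ZMod L))) := by
  refine lineHolonomy_congr 0 q _ fun r hr => hVV' _ fun hc => ?_
  rw [val_lower_of_apply_zero hb hr hq] at hc
  omega

end LinkStaples

/-! ### Downward staples on the odd torus -/

section SiteStaples

variable {j : Fin d}

omit [NeZero L] [Fact (1 < L)] [TopologicalSpace G] [IsTopologicalGroup G] [CompactSpace G]
  [MeasurableSpace G] [BorelSpace G] in
/-- **The reflection carries the downward staple of `ΘU` to the upward staple of `U`** for a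
base point `c` of the lattice plane of the odd torus (`c₀ + c₀ = 1`; hypothesis `hUp` of
`re_trace_rectangleHolonomy_eq_sum_down` for `R = Θ`). [folklore] -/
theorem upStaple_eq_downStaple_timeReflect (U : GaugeConfig d L G) {c : Site d L}
    (hc : c 0 + c 0 = 1) (hj : j ≠ 0) (a m : ℕ) :
    lineHolonomy U 0 (a + 1) c * lineHolonomy U j m (c + Pi.single 0 (((a + 1 : ℕ)) : ZMod L)) *
        (lineHolonomy U 0 (a + 1) (c + Pi.single j ((m : ℕ) : ZMod L)))⁻¹ =
      (lineHolonomy U.timeReflect 0 (a + 1) (c + Pi.single 0 (-(((a + 1 : ℕ)) : ZMod L))))⁻¹ *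
        lineHolonomy U.timeReflect j m (c + Pi.single 0 (-(((a + 1 : ℕ)) : ZMod L))) *
        lineHolonomy U.timeReflect 0 (a + 1)
          (c + Pi.single 0 (-(((a + 1 : ℕ)) : ZMod L)) + Pi.single j ((m : ℕ) : ZMod L)) := by
  have hleg : ∀ c' : Site d L, c' 0 + c' 0 = 1 →
      lineHolonomy U.timeReflect 0 (a + 1) (c' + Pi.single 0 (-(((a + 1 : ℕ)) : ZMod L))) =
        (lineHolonomy U 0 (a + 1) c')⁻¹ := by
    intro c' hc'
    refine lineHolonomy_eq_inv_of_links _ _ 0 (a + 1) _ _ fun s hs => ?_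
    rw [timeReflect_apply]
    simp only [↓reduceIte, edgeReflect]
    rw [add_single_add_single_same, timeReflect_shift_add_single_of_add_self hc']
    congr 4
    rw [Nat.cast_sub (by omega : s ≤ a + 1 - 1)]
    push_cast
    ring
  have hbot : lineHolonomy U.timeReflect j m (c + Pi.single 0 (-(((a + 1 : ℕ)) : ZMod L))) =
      lineHolonomy U j m (c + Pi.single 0 (((a + 1 : ℕ)) : ZMod L)) := by
    refine lineHolonomy_eq_of_links _ _ j m _ _ fun r _ => ?_
    rw [timeReflect_apply]
    simp only [hj, ↓reduceIte, edgeReflect]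
    have hc'' : (c + Pi.single j ((r : ℕ) : ZMod L) : Site d L) 0 + (c + Pi.single j ((r : ℕ) : ZMod L) : Site d L) 0 = 1 := by
      rw [apply_zero_add_single_of_ne _ hj]; exact hc
    rw [add_single_add_single_comm c 0 j, add_single_add_single_comm c 0 j,
      timeReflect_add_single_of_add_self hc'', neg_neg]
  have hc' : (c + Pi.single j ((m : ℕ) : ZMod L) : Site d L) 0 + (c + Pi.single j ((m : ℕ) : ZMod L) : Site d L) 0 = 1 := by
    rw [apply_zero_add_single_of_ne _ hj]; exact hc
  rw [hleg c hc, inv_inv, hbot, add_single_add_single_comm c 0 j, hleg _ hc']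

omit [TopologicalSpace G] [IsTopologicalGroup G] [CompactSpace G] [MeasurableSpace G]
  [BorelSpace G] in
/-- **The downward staple of height `h ≤ L/2`, `1 ≤ h`, hanging from the plane `t = L/2 + 1`
depends only on `P ∪ C ∪ M`** (in fact on `P`). [folklore] -/
theorem downStaple_congr_odd (hL : Odd L) (hj : j ≠ 0) {h : ℕ} (h1 : 1 ≤ h) (hh : h ≤ L / 2) (m : ℕ)
    {V V' : GaugeConfig d L G}
    (hVV' : ∀ e ∈ (((Finset.univ.filter fun e : Edge d L =>
        1 ≤ ZMod.val (Prod.fst e 0) ∧ ZMod.val (Prod.fst e 0) ≤ L / 2) ∪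
      (Finset.univ.filter fun e : Edge d L => Prod.snd e = 0 ∧ ZMod.val (Prod.fst e 0) = 0) ∪
      (Finset.univ.filter fun e : Edge d L =>
        Prod.snd e ≠ 0 ∧ ZMod.val (Prod.fst e 0) = L / 2 + 1) : Finset (Edge d L)) : Set (Edge d L)),
        V e = V' e) :
    (lineHolonomy V 0 h ((0 : Site d L) + Pi.single 0 (((L / 2 + 1 : ℕ)) : ZMod L) +
        Pi.single 0 (-((h : ℕ) : ZMod L))))⁻¹ *
      lineHolonomy V j m ((0 : Site d L) + Pi.single 0 (((L / 2 + 1 : ℕ)) : ZMod L) +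
        Pi.single 0 (-((h : ℕ) : ZMod L))) *
      lineHolonomy V 0 h ((0 : Site d L) + Pi.single 0 (((L / 2 + 1 : ℕ)) : ZMod L) +
        Pi.single 0 (-((h : ℕ) : ZMod L)) + Pi.single j ((m : ℕ) : ZMod L)) =
    (lineHolonomy V' 0 h ((0 : Site d L) + Pi.single 0 (((L / 2 + 1 : ℕ)) : ZMod L) +
        Pi.single 0 (-((h : ℕ) : ZMod L))))⁻¹ *
      lineHolonomy V' j m ((0 : Site d L) + Pi.single 0 (((L / 2 + 1 : ℕ)) : ZMod L) +
        Pi.single 0 (-((h : ℕ) : ZMod L))) *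
      lineHolonomy V' 0 h ((0 : Site d L) + Pi.single 0 (((L / 2 + 1 : ℕ)) : ZMod L) +
        Pi.single 0 (-((h : ℕ) : ZMod L)) + Pi.single j ((m : ℕ) : ZMod L)) := by
  have hP : ∀ (y : Site d L) (i : Fin d), 1 ≤ (y 0).val → (y 0).val ≤ L / 2 → V (y, i) = V' (y, i) := by
    intro y i h1' h2'
    apply hVV'
    rw [Finset.coe_union, Finset.coe_union, Set.mem_union, Set.mem_union, Finset.mem_coe,
      Finset.mem_filter]
    exact Or.inl (Or.inl ⟨Finset.mem_univ _, h1', h2'⟩)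
  have hleg : ∀ r : ZMod L, lineHolonomy V 0 h ((0 : Site d L) + Pi.single 0 (((L / 2 + 1 : ℕ)) : ZMod L) +
      Pi.single 0 (-((h : ℕ) : ZMod L)) + Pi.single j r) =
      lineHolonomy V' 0 h ((0 : Site d L) + Pi.single 0 (((L / 2 + 1 : ℕ)) : ZMod L) +
      Pi.single 0 (-((h : ℕ) : ZMod L)) + Pi.single j r) := by
    intro r
    refine lineHolonomy_congr 0 h _ fun s hs => hP _ _ ?_ ?_
    · rw [val_downStaple_site_odd hL hj hs.le (by omega)]; omega
    · rw [val_downStaple_site_odd hL hj hs.le (by omega)]; omega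
  have hleg0 := hleg 0
  simp only [Pi.single_zero, add_zero] at hleg0
  have hbot : lineHolonomy V j m ((0 : Site d L) + Pi.single 0 (((L / 2 + 1 : ℕ)) : ZMod L) +
      Pi.single 0 (-((h : ℕ) : ZMod L))) =
      lineHolonomy V' j m ((0 : Site d L) + Pi.single 0 (((L / 2 + 1 : ℕ)) : ZMod L) +
      Pi.single 0 (-((h : ℕ) : ZMod L))) := by
    refine lineHolonomy_congr j m _ fun r _ => ?_
    have hv := val_downStaple_site_odd (d := d) hL hj (Nat.zero_le h) (by omega : h ≤ L / 2 + 1) ((r : ℕ) : ZMod L)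
    simp only [Nat.cast_zero, Pi.single_zero, add_zero] at hv
    exact hP _ _ (by rw [hv]; omega) (by rw [hv]; omega)
  rw [hleg0, hbot, hleg]

omit [NeZero L] [TopologicalSpace G] [IsTopologicalGroup G] [CompactSpace G] [MeasurableSpace G]
  [BorelSpace G] in
/-- The downward staple (`h ≤ L/2`) contains no crossing link. [folklore] -/
theorem downStaple_congr_off_cross_odd (hL : Odd L) (hj : j ≠ 0) {h : ℕ} (hh : h ≤ L / 2) (m : ℕ)
    {V V' : GaugeConfig d L G}
    (hVV' : ∀ e : Edge d L, ¬ (Prod.snd e = 0 ∧ ZMod.val (Prod.fst e 0) = 0) → V e = V' e) :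
    (lineHolonomy V 0 h ((0 : Site d L) + Pi.single 0 (((L / 2 + 1 : ℕ)) : ZMod L) +
        Pi.single 0 (-((h : ℕ) : ZMod L))))⁻¹ *
      lineHolonomy V j m ((0 : Site d L) + Pi.single 0 (((L / 2 + 1 : ℕ)) : ZMod L) +
        Pi.single 0 (-((h : ℕ) : ZMod L))) *
      lineHolonomy V 0 h ((0 : Site d L) + Pi.single 0 (((L / 2 + 1 : ℕ)) : ZMod L) +
        Pi.single 0 (-((h : ℕ) : ZMod L)) + Pi.single j ((m : ℕ) : ZMod L)) =
    (lineHolonomy V' 0 h ((0 : Site d L) + Pi.single 0 (((L / 2 + 1 : ℕ)) : ZMod L) +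
        Pi.single 0 (-((h : ℕ) : ZMod L))))⁻¹ *
      lineHolonomy V' j m ((0 : Site d L) + Pi.single 0 (((L / 2 + 1 : ℕ)) : ZMod L) +
        Pi.single 0 (-((h : ℕ) : ZMod L))) *
      lineHolonomy V' 0 h ((0 : Site d L) + Pi.single 0 (((L / 2 + 1 : ℕ)) : ZMod L) +
        Pi.single 0 (-((h : ℕ) : ZMod L)) + Pi.single j ((m : ℕ) : ZMod L)) := by
  have hleg : ∀ r : ZMod L, lineHolonomy V 0 h ((0 : Site d L) + Pi.single 0 (((L / 2 + 1 : ℕ)) : ZMod L) +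
      Pi.single 0 (-((h : ℕ) : ZMod L)) + Pi.single j r) =
      lineHolonomy V' 0 h ((0 : Site d L) + Pi.single 0 (((L / 2 + 1 : ℕ)) : ZMod L) +
      Pi.single 0 (-((h : ℕ) : ZMod L)) + Pi.single j r) := by
    intro r
    refine lineHolonomy_congr 0 h _ fun s hs => hVV' _ fun hc => ?_
    obtain ⟨-, hc⟩ := hc
    simp only at hc
    rw [val_downStaple_site_odd hL hj hs.le (by omega)] at hc
    omega
  have hleg0 := hleg 0
  simp only [Pi.single_zero, add_zero] at hleg0
  rw [hleg0, hleg, lineHolonomy_congr j m _ fun r _ => hVV' _ fun hc => hj hc.1]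

omit [NeZero L] [TopologicalSpace G] [IsTopologicalGroup G] [CompactSpace G] [MeasurableSpace G]
  [BorelSpace G] in
/-- The upward staple (`a + 1 ≤ L/2`) contains no crossing link. [folklore] -/
theorem upStaple_congr_off_cross_odd (hL : Odd L) (hj : j ≠ 0) {a : ℕ} (ha : a + 1 ≤ L / 2) (m : ℕ)
    {V V' : GaugeConfig d L G}
    (hVV' : ∀ e : Edge d L, ¬ (Prod.snd e = 0 ∧ ZMod.val (Prod.fst e 0) = 0) → V e = V' e) :
    lineHolonomy V 0 (a + 1) ((0 : Site d L) + Pi.single 0 (((L / 2 + 1 : ℕ)) : ZMod L)) *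
        lineHolonomy V j m ((0 : Site d L) + Pi.single 0 (((L / 2 + 1 : ℕ)) : ZMod L) +
          Pi.single 0 (((a + 1 : ℕ)) : ZMod L)) *
        (lineHolonomy V 0 (a + 1) ((0 : Site d L) + Pi.single 0 (((L / 2 + 1 : ℕ)) : ZMod L) +
          Pi.single j ((m : ℕ) : ZMod L)))⁻¹ =
      lineHolonomy V' 0 (a + 1) ((0 : Site d L) + Pi.single 0 (((L / 2 + 1 : ℕ)) : ZMod L)) *
        lineHolonomy V' j m ((0 : Site d L) + Pi.single 0 (((L / 2 + 1 : ℕ)) : ZMod L) +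
          Pi.single 0 (((a + 1 : ℕ)) : ZMod L)) *
        (lineHolonomy V' 0 (a + 1) ((0 : Site d L) + Pi.single 0 (((L / 2 + 1 : ℕ)) : ZMod L) +
          Pi.single j ((m : ℕ) : ZMod L)))⁻¹ := by
  have h1L : 1 < L := Fact.out
  have hO := Nat.odd_iff.mp hL
  -- time coordinates on the upward staple: `L/2 + 1 + s`
  have hval : ∀ (r : ZMod L) (s : ℕ), s ≤ a →
      (((0 : Site d L) + Pi.single 0 (((L / 2 + 1 : ℕ)) : ZMod L) + Pi.single j r +
        Pi.single 0 ((s : ℕ) : ZMod L) : Site d L) 0).val = L / 2 + 1 + s := by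
    intro r s hs
    simp only [Pi.add_apply, Pi.single_eq_same, Pi.single_eq_of_ne (Ne.symm hj), zero_add, add_zero]
    rw [← Nat.cast_add, ZMod.val_cast_of_lt (by omega)]
  have hleg : ∀ r : ZMod L, lineHolonomy V 0 (a + 1) ((0 : Site d L) + Pi.single 0 (((L / 2 + 1 : ℕ)) : ZMod L) +
      Pi.single j r) = lineHolonomy V' 0 (a + 1) ((0 : Site d L) + Pi.single 0 (((L / 2 + 1 : ℕ)) : ZMod L) +
      Pi.single j r) := by
    intro r
    refine lineHolonomy_congr 0 (a + 1) _ fun s hs => hVV' _ fun hc => ?_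
    obtain ⟨-, hc⟩ := hc
    simp only at hc
    rw [hval r s (Nat.lt_succ_iff.mp hs)] at hc
    omega
  have hleg0 := hleg 0
  simp only [Pi.single_zero, add_zero] at hleg0
  rw [hleg0, hleg, lineHolonomy_congr j m _ fun r _ => hVV' _ fun hc => hj hc.1]

end SiteStaples


/-! ### The weighted loops after the splitting (odd torus) -/

section Bridges

local notation "CSo" => (Finset.univ.filter fun e : Edge d L =>
  Prod.snd e = 0 ∧ ZMod.val (Prod.fst e 0) = 0)
local notation "AposO[" V "]" => (∑ p ∈ Finset.univ.filter (fun p : Plaquette d L =>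
  1 ≤ ZMod.val (Prod.fst p 0) ∧ ZMod.val (Prod.fst p 0) ≤ L / 2), plaqRe ρ V p)
local notation "AMO[" V "]" => (∑ p ∈ Finset.univ.filter (fun p : Plaquette d L =>
  Prod.fst (Subtype.val (Prod.snd p)) ≠ 0 ∧ ZMod.val (Prod.fst p 0) = L / 2 + 1), plaqRe ρ V p)
local notation "XO[" V "]" => (∑ p ∈ Finset.univ.filter (fun p : Plaquette d L =>
  Prod.fst (Subtype.val (Prod.snd p)) = 0 ∧ ZMod.val (Prod.fst p 0) = 0), plaqRe ρ V p)
set_option quotPrecheck false in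
local notation "tL[" Y "," U "]" => (fun e' : Edge d L =>
  U e' * (if Prod.snd e' = 0 ∧ ZMod.val (Prod.fst e' 0) = 0 then Y e' else 1))
set_option quotPrecheck false in
local notation "cLow[" hρ "," β "]" => (fun (i : CoeffIndex d L N) (V : GaugeConfig d L G) =>
  if Prod.fst (Subtype.val (Prod.snd (Prod.fst i))) = 0 ∧ ZMod.val (Prod.fst (Prod.fst i) 0) = 0 then
    (Real.sqrt (β / 2) : ℂ) *
      (if i.2.2.2 then CompactGroup.unitarize ρ hρ (halfPlaq i.1 V) i.2.1 i.2.2.1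
        else conj (CompactGroup.unitarize ρ hρ (halfPlaq i.1 V) i.2.1 i.2.2.1))
  else 0)

variable {j : Fin d}

omit [MeasurableSpace G] [BorelSpace G] in
/-- Real factors through the real part: `Re (u e^{r₁} · (conj v · e^{r₂}) · e^{r₃}) =
e^{r₁} e^{r₂} e^{r₃} Re (u conj v)`. [folklore] -/
theorem re_mul_ofReal_exp (u v : ℂ) (r₁ r₂ r₃ : ℝ) :
    (u * ((Real.exp r₁ : ℝ) : ℂ) * (conj v * ((Real.exp r₂ : ℝ) : ℂ)) * ((Real.exp r₃ : ℝ) : ℂ)).re =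
      Real.exp r₁ * Real.exp r₂ * Real.exp r₃ * (u * conj v).re := by
  have : u * ((Real.exp r₁ : ℝ) : ℂ) * (conj v * ((Real.exp r₂ : ℝ) : ℂ)) * ((Real.exp r₃ : ℝ) : ℂ) =
    ((Real.exp r₁ * Real.exp r₂ * Real.exp r₃ : ℝ) : ℂ) * (u * conj v) := by push_cast; ring
  rw [this, Complex.re_ofReal_mul]

omit [MeasurableSpace G] [BorelSpace G] in
/-- **The weighted odd-height loop after the splitting, odd torus** (pointwise identity): for
the loop with `q` links below and `p` links above the link plane `t = ½` (`p + 1, q + 1 ≤ L/2`),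
`e^{-βS(V)} W(V) = e^{-βN#plaq} N⁻¹ Re ∑_{kl} Φ^p_{kl}(z) conj Φ^q_{kl}(ΘU) K(U,Y)`, `V = tL(Y,U)`,
`z = splice_C(U, Y)`, `Φ^h_{kl} = σ(extended staple)_{kl} e^{β(A + A_M/2)}`. [folklore] -/
theorem weight_mul_wilsonLoop_link_odd (hL : Odd L) (hρ : Continuous ρ) {β : ℝ} (hβ : 0 ≤ β)
    (hj : j ≠ 0) {p q : ℕ} (hp : p + 1 ≤ L / 2) (hq : q + 1 ≤ L / 2) (m : ℕ) (U Y : GaugeConfig d L G) :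
    Real.exp (-β * wilsonAction ρ (tL[Y, U])) *
        wilsonLoop ρ ((0 : Site d L) + Pi.single 0 (-((q : ℕ) : ZMod L))) 0 j (q + (p + 1)) m (tL[Y, U]) =
      Real.exp (-β * (N * Fintype.card (Plaquette d L))) * (N : ℝ)⁻¹ *
        (∑ kl : Fin N × Fin N,
          (CompactGroup.unitarize ρ hρ
              (lineHolonomy (LatticeRP.splice (CSo) (U, Y)) 0 (p + 1) (0 : Site d L) *
                lineHolonomy (LatticeRP.splice (CSo) (U, Y)) j m ((0 : Site d L) + Pi.single 0 (((p + 1 : ℕ)) : ZMod L)) *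
                (lineHolonomy (LatticeRP.splice (CSo) (U, Y)) 0 (p + 1)
                  ((0 : Site d L) + Pi.single j ((m : ℕ) : ZMod L)))⁻¹) kl.1 kl.2 *
            ((Real.exp (β * (AposO[LatticeRP.splice (CSo) (U, Y)] + AMO[LatticeRP.splice (CSo) (U, Y)] / 2)) : ℝ) : ℂ)) *
          conj (CompactGroup.unitarize ρ hρ
              (lineHolonomy U.timeReflect 0 (q + 1) (0 : Site d L) *
                lineHolonomy U.timeReflect j m ((0 : Site d L) + Pi.single 0 (((q + 1 : ℕ)) : ZMod L)) *
                (lineHolonomy U.timeReflect 0 (q + 1) ((0 : Site d L) + Pi.single j ((m : ℕ) : ZMod L)))⁻¹) kl.1 kl.2 *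
            ((Real.exp (β * (AposO[U.timeReflect] + AMO[U.timeReflect] / 2)) : ℝ) : ℂ)) *
          Complex.exp (∑ i : CoeffIndex d L N, cLow[hρ, β] i (LatticeRP.splice (CSo) (U, Y)) *
            conj (cLow[hρ, β] i U.timeReflect))).re := by
  have h1L : 1 < L := Fact.out
  have hO := Nat.odd_iff.mp hL
  have ha : (0 : Site d L) 0 = 0 := rfl
  have hb' : ((0 : Site d L) + Pi.single j ((m : ℕ) : ZMod L) : Site d L) 0 = 0 :=
    add_single_apply_zero_of_ne ha hj _
  -- the action pieces in the three configurations
  have hA1 : AposO[tL[Y, U]] = AposO[U] := sumPos_congr_off_cross ρ (translateLower_agree_off_cross Y U)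
  have hA2 : AposO[GaugeConfig.timeReflect (tL[Y, U])] = AposO[U.timeReflect] :=
    sumPos_timeReflect_translateLower ρ Y U
  have hM1 : AMO[tL[Y, U]] = AMO[U] := sumM_congr_off_cross ρ (translateLower_agree_off_cross Y U)
  have hAz : AposO[LatticeRP.splice (CSo) (U, Y)] = AposO[U] :=
    sumPos_congr_off_cross ρ (spliceLower_agree_off_cross U Y)
  have hMz : AMO[LatticeRP.splice (CSo) (U, Y)] = AMO[U] :=
    sumM_congr_off_cross ρ (spliceLower_agree_off_cross U Y)
  have hMΘ : AMO[U.timeReflect] = AMO[U] := sumM_timeReflect_odd ρ hL U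
  have hK : Complex.exp (∑ i : CoeffIndex d L N, cLow[hρ, β] i (LatticeRP.splice (CSo) (U, Y)) *
      conj (cLow[hρ, β] i U.timeReflect)) = ((Real.exp (β * XO[tL[Y, U]]) : ℝ) : ℂ) := by
    rw [sum_coeffLower_mul_conj ρ hρ hβ U Y, Complex.ofReal_exp]
  -- the loop as a scalar product of extended staples
  have hcross0 : Prod.snd (((0 : Site d L), (0 : Fin d)) : Edge d L) = 0 ∧
      ZMod.val (Prod.fst (((0 : Site d L), (0 : Fin d)) : Edge d L) 0) = 0 := ⟨rfl, by simp⟩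
  have hcrossm : Prod.snd ((((0 : Site d L) + Pi.single j ((m : ℕ) : ZMod L)), (0 : Fin d)) : Edge d L) = 0 ∧
      ZMod.val (Prod.fst ((((0 : Site d L) + Pi.single j ((m : ℕ) : ZMod L)), (0 : Fin d)) : Edge d L) 0) = 0 :=
    ⟨rfl, by rw [show Prod.fst ((((0 : Site d L) + Pi.single j ((m : ℕ) : ZMod L)), (0 : Fin d)) : Edge d L) 0 = 0
      from hb', ZMod.val_zero]⟩
  have htrace := re_trace_rectangleHolonomy_eq_sum ρ hρ U (tL[Y, U]) (LatticeRP.splice (CSo) (U, Y)) Y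
    ha hj q p m
    (lineHolonomy_lower_congr_off_cross ha (by omega) (translateLower_agree_off_cross Y U))
    (by rw [add_single_add_single_comm]
        exact lineHolonomy_lower_congr_off_cross hb' (by omega) (translateLower_agree_off_cross Y U))
    (lineHolonomy_congr j m _ fun _ _ => translateLower_apply_of_ne_zero Y U (e := (_, j)) hj)
    (translateLower_apply_of_cross Y U hcross0) (translateLower_apply_of_cross Y U hcrossm)
    (spliceLower_apply_of_cross U Y hcross0) (spliceLower_apply_of_cross U Y hcrossm)
    ((innerStaple_congr_off_cross ha hj hp m (translateLower_agree_off_cross Y U)).trans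
      (innerStaple_congr_off_cross ha hj hp m (spliceLower_agree_off_cross U Y)).symm)
  -- assemble
  rw [wilsonLoop, htrace, wilsonAction_split_odd ρ hL hρ, hA1, hA2, hM1]
  simp only [hAz, hMz, hMΘ, hK, map_mul (starRingEnd ℂ), Complex.conj_ofReal]
  rw [Fintype.sum_prod_type]
  simp only [Complex.re_sum, re_mul_ofReal_exp, ← Finset.mul_sum]
  rw [← Real.exp_add, ← Real.exp_add,
    show -β * (↑N * ↑(Fintype.card (Plaquette d L)) -
        (AposO[U] + AposO[U.timeReflect] + XO[tL[Y, U]] + AMO[U])) =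
      -β * (↑N * ↑(Fintype.card (Plaquette d L))) +
        (β * (AposO[U] + AMO[U] / 2) + β * (AposO[U.timeReflect] + AMO[U] / 2) + β * XO[tL[Y, U]]) by ring,
    Real.exp_add]
  ring

omit [MeasurableSpace G] [BorelSpace G] in
/-- **The weighted even-height loop after the splitting, odd torus** (pointwise identity): for
the loop with `b` links below and `a + 1` links above the lattice plane `t = L/2 + 1`
(`b ≤ L/2`, `a + 1 ≤ L/2`), `e^{-βS(V)} W(V) = e^{-βN#plaq} N⁻¹ Re ∑_{kl} Ψ^b_{kl}(z) conj Ψ^{a+1}_{kl}(ΘU) K`,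
`Ψ^h_{kl} = σ(downward staple)_{kl} e^{β(A + A_M/2)}`. [folklore] -/
theorem weight_mul_wilsonLoop_site_odd (hL : Odd L) (hρ : Continuous ρ) {β : ℝ} (hβ : 0 ≤ β)
    (hj : j ≠ 0) {b a : ℕ} (hb : b ≤ L / 2) (ha : a + 1 ≤ L / 2) (m : ℕ) (U Y : GaugeConfig d L G) :
    Real.exp (-β * wilsonAction ρ (tL[Y, U])) *
        wilsonLoop ρ ((0 : Site d L) + Pi.single 0 (((L / 2 + 1 : ℕ)) : ZMod L) +
          Pi.single 0 (-((b : ℕ) : ZMod L))) 0 j (b + (a + 1)) m (tL[Y, U]) =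
      Real.exp (-β * (N * Fintype.card (Plaquette d L))) * (N : ℝ)⁻¹ *
        (∑ kl : Fin N × Fin N,
          (CompactGroup.unitarize ρ hρ
              ((lineHolonomy (LatticeRP.splice (CSo) (U, Y)) 0 b ((0 : Site d L) +
                  Pi.single 0 (((L / 2 + 1 : ℕ)) : ZMod L) + Pi.single 0 (-((b : ℕ) : ZMod L))))⁻¹ *
                lineHolonomy (LatticeRP.splice (CSo) (U, Y)) j m ((0 : Site d L) +
                  Pi.single 0 (((L / 2 + 1 : ℕ)) : ZMod L) + Pi.single 0 (-((b : ℕ) : ZMod L))) *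
                lineHolonomy (LatticeRP.splice (CSo) (U, Y)) 0 b ((0 : Site d L) +
                  Pi.single 0 (((L / 2 + 1 : ℕ)) : ZMod L) + Pi.single 0 (-((b : ℕ) : ZMod L)) +
                  Pi.single j ((m : ℕ) : ZMod L))) kl.1 kl.2 *
            ((Real.exp (β * (AposO[LatticeRP.splice (CSo) (U, Y)] + AMO[LatticeRP.splice (CSo) (U, Y)] / 2)) : ℝ) : ℂ)) *
          conj (CompactGroup.unitarize ρ hρ
              ((lineHolonomy U.timeReflect 0 (a + 1) ((0 : Site d L) +
                  Pi.single 0 (((L / 2 + 1 : ℕ)) : ZMod L) + Pi.single 0 (-(((a + 1 : ℕ)) : ZMod L))))⁻¹ *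
                lineHolonomy U.timeReflect j m ((0 : Site d L) +
                  Pi.single 0 (((L / 2 + 1 : ℕ)) : ZMod L) + Pi.single 0 (-(((a + 1 : ℕ)) : ZMod L))) *
                lineHolonomy U.timeReflect 0 (a + 1) ((0 : Site d L) +
                  Pi.single 0 (((L / 2 + 1 : ℕ)) : ZMod L) + Pi.single 0 (-(((a + 1 : ℕ)) : ZMod L)) +
                  Pi.single j ((m : ℕ) : ZMod L))) kl.1 kl.2 *
            ((Real.exp (β * (AposO[U.timeReflect] + AMO[U.timeReflect] / 2)) : ℝ) : ℂ)) *
          Complex.exp (∑ i : CoeffIndex d L N, cLow[hρ, β] i (LatticeRP.splice (CSo) (U, Y)) *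
            conj (cLow[hρ, β] i U.timeReflect))).re := by
  have h1L : 1 < L := Fact.out
  have hO := Nat.odd_iff.mp hL
  have hc2 : ((0 : Site d L) + Pi.single 0 (((L / 2 + 1 : ℕ)) : ZMod L) : Site d L) 0 +
      ((0 : Site d L) + Pi.single 0 (((L / 2 + 1 : ℕ)) : ZMod L) : Site d L) 0 = 1 := by
    simp only [Pi.add_apply, Pi.zero_apply, Pi.single_eq_same, zero_add]
    exact cast_half_succ_add_self hL
  have hA1 : AposO[tL[Y, U]] = AposO[U] := sumPos_congr_off_cross ρ (translateLower_agree_off_cross Y U)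
  have hA2 : AposO[GaugeConfig.timeReflect (tL[Y, U])] = AposO[U.timeReflect] :=
    sumPos_timeReflect_translateLower ρ Y U
  have hM1 : AMO[tL[Y, U]] = AMO[U] := sumM_congr_off_cross ρ (translateLower_agree_off_cross Y U)
  have hAz : AposO[LatticeRP.splice (CSo) (U, Y)] = AposO[U] :=
    sumPos_congr_off_cross ρ (spliceLower_agree_off_cross U Y)
  have hMz : AMO[LatticeRP.splice (CSo) (U, Y)] = AMO[U] :=
    sumM_congr_off_cross ρ (spliceLower_agree_off_cross U Y)
  have hMΘ : AMO[U.timeReflect] = AMO[U] := sumM_timeReflect_odd ρ hL U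
  have hK : Complex.exp (∑ i : CoeffIndex d L N, cLow[hρ, β] i (LatticeRP.splice (CSo) (U, Y)) *
      conj (cLow[hρ, β] i U.timeReflect)) = ((Real.exp (β * XO[tL[Y, U]]) : ℝ) : ℂ) := by
    rw [sum_coeffLower_mul_conj ρ hρ hβ U Y, Complex.ofReal_exp]
  -- the loop as a scalar product of downward staples
  have hUp := (upStaple_congr_off_cross_odd hL hj ha m (translateLower_agree_off_cross Y U)).trans
    (upStaple_eq_downStaple_timeReflect U hc2 hj a m)
  have htrace := re_trace_rectangleHolonomy_eq_sum_down ρ hρ (tL[Y, U]) U.timeReflect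
    ((0 : Site d L) + Pi.single 0 (((L / 2 + 1 : ℕ)) : ZMod L)) j b a m hUp
  have hSb := (downStaple_congr_off_cross_odd hL hj hb m (translateLower_agree_off_cross Y U)).trans
    (downStaple_congr_off_cross_odd hL hj hb m (spliceLower_agree_off_cross U Y)).symm
  -- assemble
  rw [wilsonLoop, htrace, hSb, wilsonAction_split_odd ρ hL hρ, hA1, hA2, hM1]
  simp only [hAz, hMz, hMΘ, hK, map_mul (starRingEnd ℂ), Complex.conj_ofReal]
  rw [Fintype.sum_prod_type]
  simp only [Complex.re_sum, re_mul_ofReal_exp, ← Finset.mul_sum]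
  rw [← Real.exp_add, ← Real.exp_add,
    show -β * (↑N * ↑(Fintype.card (Plaquette d L)) -
        (AposO[U] + AposO[U.timeReflect] + XO[tL[Y, U]] + AMO[U])) =
      -β * (↑N * ↑(Fintype.card (Plaquette d L))) +
        (β * (AposO[U] + AMO[U] / 2) + β * (AposO[U.timeReflect] + AMO[U] / 2) + β * XO[tL[Y, U]]) by ring,
    Real.exp_add]
  ring

end Bridges


/-! ### The inequalities for the torus Wilson state on the odd torus -/

section Main

local notation "PSo" => (Finset.univ.filter fun e : Edge d L =>
  1 ≤ ZMod.val (Prod.fst e 0) ∧ ZMod.val (Prod.fst e 0) ≤ L / 2)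
local notation "CSo" => (Finset.univ.filter fun e : Edge d L =>
  Prod.snd e = 0 ∧ ZMod.val (Prod.fst e 0) = 0)
local notation "MSo" => (Finset.univ.filter fun e : Edge d L =>
  Prod.snd e ≠ 0 ∧ ZMod.val (Prod.fst e 0) = L / 2 + 1)
local notation "AposO[" V "]" => (∑ p ∈ Finset.univ.filter (fun p : Plaquette d L =>
  1 ≤ ZMod.val (Prod.fst p 0) ∧ ZMod.val (Prod.fst p 0) ≤ L / 2), plaqRe ρ V p)
local notation "AMO[" V "]" => (∑ p ∈ Finset.univ.filter (fun p : Plaquette d L =>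
  Prod.fst (Subtype.val (Prod.snd p)) ≠ 0 ∧ ZMod.val (Prod.fst p 0) = L / 2 + 1), plaqRe ρ V p)

variable {j : Fin d}

omit [Fact (1 < L)] [CompactSpace G] in
/-- The positive-side Boltzmann factor `e^{β(A + A_M/2)}` of the odd torus is measurable.
[folklore] -/
theorem measurable_weightOdd (hρ : Continuous ρ) (β : ℝ) :
    Measurable fun V : GaugeConfig d L G => ((Real.exp (β * (AposO[V] + AMO[V] / 2)) : ℝ) : ℂ) :=
  Complex.measurable_ofReal.comp ((((Finset.measurable_sum _ fun p _ => measurable_plaqRe ρ hρ p).add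
    ((Finset.measurable_sum _ fun p _ => measurable_plaqRe ρ hρ p).div_const _)).const_mul β).exp)

omit [Fact (1 < L)] [MeasurableSpace G] [BorelSpace G] in
/-- The positive-side Boltzmann factor of the odd torus is bounded by `e^{2|β|N#plaquettes}`.
[folklore] -/
theorem norm_weightOdd_le [MeasurableSpace G] (hρ : Continuous ρ) (β : ℝ) (V : GaugeConfig d L G) :
    ‖(((Real.exp (β * (AposO[V] + AMO[V] / 2)) : ℝ) : ℂ))‖ ≤
      Real.exp (|β| * (2 * (N * Fintype.card (Plaquette d L)))) := by
  rw [Complex.norm_real, Real.norm_eq_abs, abs_of_pos (Real.exp_pos _)]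
  have hA := abs_sum_plaqRe_le ρ hρ (Finset.univ.filter (fun p : Plaquette d L =>
    1 ≤ ZMod.val (Prod.fst p 0) ∧ ZMod.val (Prod.fst p 0) ≤ L / 2)) V
  have hM := abs_sum_plaqRe_le ρ hρ (Finset.univ.filter (fun p : Plaquette d L =>
    Prod.fst (Subtype.val (Prod.snd p)) ≠ 0 ∧ ZMod.val (Prod.fst p 0) = L / 2 + 1)) V
  refine Real.exp_le_exp.2 ?_
  calc β * (AposO[V] + AMO[V] / 2) ≤ |β * (AposO[V] + AMO[V] / 2)| := le_abs_self _
    _ = |β| * |AposO[V] + AMO[V] / 2| := abs_mul _ _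
    _ ≤ |β| * (2 * (N * Fintype.card (Plaquette d L))) := by
        refine mul_le_mul_of_nonneg_left ?_ (abs_nonneg _)
        calc |AposO[V] + AMO[V] / 2| ≤ |AposO[V]| + |AMO[V] / 2| := abs_add_le _ _
          _ ≤ N * Fintype.card (Plaquette d L) + N * Fintype.card (Plaquette d L) := by
              rw [abs_div, abs_two]
              exact add_le_add hA (by linarith [hM, abs_nonneg (AMO[V])])
          _ = 2 * (N * Fintype.card (Plaquette d L)) := by ring

omit [TopologicalSpace G] [IsTopologicalGroup G] [CompactSpace G] [MeasurableSpace G] [BorelSpace G] in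
/-- The positive-side Boltzmann factor depends only on `P ∪ C ∪ M`. [folklore] -/
theorem weightOdd_congr (hL : Odd L) (β : ℝ) {U V : GaugeConfig d L G}
    (hUV : ∀ e ∈ (((PSo) ∪ (CSo) ∪ (MSo) : Finset (Edge d L)) : Set (Edge d L)), U e = V e) :
    Real.exp (β * (AposO[U] + AMO[U] / 2)) = Real.exp (β * (AposO[V] + AMO[V] / 2)) := by
  rw [sumPos_congr_of_agree ρ hL hUV, sumM_congr_of_agree ρ hUV]

/-- **Odd-height rectangular Wilson loops have non-negative expectation on the odd torus**
(`β ≥ 0`, `p + 1 ≤ L/2`), and **log-convexity across the link planes** holds: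
`0 ≤ ⟨W_{(2p+1)×m}⟩` and `⟨W_{(q+1+p)×m}⟩² ≤ ⟨W_{(2p+1)×m}⟩ ⟨W_{(2q+1)×m}⟩`. (Osterwalder–Seiler
reflection positivity of the mixed reflection of the odd torus, extended staples across the
hyperplane `t = ½`; Seiler LNP 159 §2.) [folklore] -/
theorem wilsonExpectation_wilsonLoop_link_oddTorus (hL : Odd L) (hρ : Continuous ρ) {β : ℝ}
    (hβ : 0 ≤ β) (hj : j ≠ 0) {p q : ℕ} (hp : p + 1 ≤ L / 2) (hq : q + 1 ≤ L / 2) (m : ℕ) :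
    0 ≤ wilsonExpectation ρ β (wilsonLoop ρ (0 : Site d L) 0 j (p + (p + 1)) m) ∧
    wilsonExpectation ρ β (wilsonLoop ρ (0 : Site d L) 0 j (q + (p + 1)) m) ^ 2 ≤
      wilsonExpectation ρ β (wilsonLoop ρ (0 : Site d L) 0 j (p + (p + 1)) m) *
        wilsonExpectation ρ β (wilsonLoop ρ (0 : Site d L) 0 j (q + (q + 1)) m) := by
  have h1L : 1 < L := Fact.out
  have hO := Nat.odd_iff.mp hL
  have ha : (0 : Site d L) 0 = 0 := rfl
  -- the families
  set g : ℕ → Fin N × Fin N → GaugeConfig d L G → ℂ := fun h kl V =>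
    CompactGroup.unitarize ρ hρ (lineHolonomy V 0 (h + 1) (0 : Site d L) *
        lineHolonomy V j m ((0 : Site d L) + Pi.single 0 (((h + 1 : ℕ)) : ZMod L)) *
        (lineHolonomy V 0 (h + 1) ((0 : Site d L) + Pi.single j ((m : ℕ) : ZMod L)))⁻¹) kl.1 kl.2 *
      ((Real.exp (β * (AposO[V] + AMO[V] / 2)) : ℝ) : ℂ) with hg
  have hgm : ∀ h kl, Measurable (g h kl) := fun h kl =>
    (measurable_unitarize_staple ρ hρ h m kl.1 kl.2).mul (measurable_weightOdd ρ hρ β)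
  have hgb : ∀ h kl U, ‖g h kl U‖ ≤ 1 * Real.exp (|β| * (2 * (N * Fintype.card (Plaquette d L)))) := by
    intro h kl U
    rw [hg]; dsimp only
    rw [norm_mul]
    exact mul_le_mul (norm_unitarize_staple_le ρ hρ h m kl.1 kl.2 U) (norm_weightOdd_le ρ hρ β U)
      (norm_nonneg _) zero_le_one
  have hgd : ∀ h, h + 1 ≤ L / 2 → ∀ kl, DependsOn (g h kl)
      (((PSo) ∪ (CSo) ∪ (MSo) : Finset (Edge d L)) : Set (Edge d L)) := by
    intro h hh kl U V hUV
    rw [hg]; dsimp only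
    rw [staple_congr_odd ha hj hh m hUV, weightOdd_congr ρ hL β hUV]
  -- the three weighted loops
  have hI := oddIntegral_sq_le ρ hL hρ β (κ := Real.exp (-β * (N * Fintype.card (Plaquette d L))) * (N : ℝ)⁻¹)
    (by positivity) (hgm p) (hgm q) (hgb p) (hgb q) (hgd p hp) (hgd q hq)
    (wilsonLoop ρ ((0 : Site d L) + Pi.single 0 (-((q : ℕ) : ZMod L))) 0 j (q + (p + 1)) m)
    (wilsonLoop ρ ((0 : Site d L) + Pi.single 0 (-((p : ℕ) : ZMod L))) 0 j (p + (p + 1)) m)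
    (wilsonLoop ρ ((0 : Site d L) + Pi.single 0 (-((q : ℕ) : ZMod L))) 0 j (q + (q + 1)) m)
    (measurable_wilsonLoop ρ hρ _ _ _ _ _) (measurable_wilsonLoop ρ hρ _ _ _ _ _)
    (measurable_wilsonLoop ρ hρ _ _ _ _ _) (by
      intro ΦΨ hmem U Y
      simp only [List.mem_cons, List.mem_nil_iff, or_false] at hmem
      rcases hmem with rfl | rfl | rfl
      · exact weight_mul_wilsonLoop_link_odd ρ hL hρ hβ hj hp hq m U Y
      · exact weight_mul_wilsonLoop_link_odd ρ hL hρ hβ hj hp hp m U Y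
      · exact weight_mul_wilsonLoop_link_odd ρ hL hρ hβ hj hq hq m U Y)
  obtain ⟨h0, hsq⟩ := hI
  rw [← wilsonExpectation_wilsonLoop_eq_zero_base ρ β ((0 : Site d L) + Pi.single 0 (-((q : ℕ) : ZMod L)))
      0 j (q + (p + 1)),
    ← wilsonExpectation_wilsonLoop_eq_zero_base ρ β ((0 : Site d L) + Pi.single 0 (-((p : ℕ) : ZMod L)))
      0 j (p + (p + 1)),
    ← wilsonExpectation_wilsonLoop_eq_zero_base ρ β ((0 : Site d L) + Pi.single 0 (-((q : ℕ) : ZMod L)))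
      0 j (q + (q + 1)),
    wilsonExpectation_real_eq_toReal_mul_integral ρ hρ, wilsonExpectation_real_eq_toReal_mul_integral ρ hρ,
    wilsonExpectation_real_eq_toReal_mul_integral ρ hρ]
  refine ⟨mul_nonneg ENNReal.toReal_nonneg h0, ?_⟩
  rw [mul_pow, mul_mul_mul_comm, ← sq]
  exact mul_le_mul_of_nonneg_left hsq (sq_nonneg _)

/-- **Even-height rectangular Wilson loops have non-negative expectation on the odd torus**
(`1 ≤ b ≤ L/2`), and **log-convexity across the lattice plane** holds (`a + 1 ≤ L/2`):
`0 ≤ ⟨W_{2b×m}⟩` and `⟨W_{(b+a+1)×m}⟩² ≤ ⟨W_{2b×m}⟩ ⟨W_{2(a+1)×m}⟩`. (Reflection positivity of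
the mixed reflection, downward staples from the lattice plane `t = L/2 + 1`; Seiler LNP 159 §2.)
[folklore] -/
theorem wilsonExpectation_wilsonLoop_site_oddTorus (hL : Odd L) (hρ : Continuous ρ) {β : ℝ}
    (hβ : 0 ≤ β) (hj : j ≠ 0) {b a : ℕ} (hb1 : 1 ≤ b) (hb : b ≤ L / 2) (ha : a + 1 ≤ L / 2) (m : ℕ) :
    0 ≤ wilsonExpectation ρ β (wilsonLoop ρ (0 : Site d L) 0 j (b + b) m) ∧
    wilsonExpectation ρ β (wilsonLoop ρ (0 : Site d L) 0 j (b + (a + 1)) m) ^ 2 ≤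
      wilsonExpectation ρ β (wilsonLoop ρ (0 : Site d L) 0 j (b + b) m) *
        wilsonExpectation ρ β (wilsonLoop ρ (0 : Site d L) 0 j ((a + 1) + (a + 1)) m) := by
  have h1L : 1 < L := Fact.out
  have hO := Nat.odd_iff.mp hL
  -- the families
  set g : ℕ → Fin N × Fin N → GaugeConfig d L G → ℂ := fun h kl V =>
    CompactGroup.unitarize ρ hρ
        ((lineHolonomy V 0 h ((0 : Site d L) + Pi.single 0 (((L / 2 + 1 : ℕ)) : ZMod L) +
            Pi.single 0 (-((h : ℕ) : ZMod L))))⁻¹ *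
          lineHolonomy V j m ((0 : Site d L) + Pi.single 0 (((L / 2 + 1 : ℕ)) : ZMod L) +
            Pi.single 0 (-((h : ℕ) : ZMod L))) *
          lineHolonomy V 0 h ((0 : Site d L) + Pi.single 0 (((L / 2 + 1 : ℕ)) : ZMod L) +
            Pi.single 0 (-((h : ℕ) : ZMod L)) + Pi.single j ((m : ℕ) : ZMod L))) kl.1 kl.2 *
      ((Real.exp (β * (AposO[V] + AMO[V] / 2)) : ℝ) : ℂ) with hg
  have hσ := CompactGroup.continuous_unitarize ρ hρ
  have hgm : ∀ h kl, Measurable (g h kl) := fun h kl =>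
    ((((entryMeasurable_lineHolonomy_inv hσ 0 h _).mul (entryMeasurable_lineHolonomy hσ j m _)).mul
      (entryMeasurable_lineHolonomy hσ 0 h _)) kl.1 kl.2).mul (measurable_weightOdd ρ hρ β)
  have hgb : ∀ h kl U, ‖g h kl U‖ ≤ 1 * Real.exp (|β| * (2 * (N * Fintype.card (Plaquette d L)))) := by
    intro h kl U
    rw [hg]; dsimp only
    rw [norm_mul]
    exact mul_le_mul (CompactGroup.norm_unitarize_apply_le_one ρ hρ _ _ _) (norm_weightOdd_le ρ hρ β U)
      (norm_nonneg _) zero_le_one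
  have hgd : ∀ h, 1 ≤ h → h ≤ L / 2 → ∀ kl, DependsOn (g h kl)
      (((PSo) ∪ (CSo) ∪ (MSo) : Finset (Edge d L)) : Set (Edge d L)) := by
    intro h h1 hh kl U V hUV
    rw [hg]; dsimp only
    rw [downStaple_congr_odd hL hj h1 hh m hUV, weightOdd_congr ρ hL β hUV]
  -- the bridge for `(b, b-1)` has `b - 1 + 1` in place of `b`
  have hbb : ∀ U Y : GaugeConfig d L G, _ := fun U Y =>
    weight_mul_wilsonLoop_site_odd ρ hL hρ hβ hj hb (a := b - 1) (by omega) m U Y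
  simp only [show b - 1 + 1 = b by omega] at hbb
  have hI := oddIntegral_sq_le ρ hL hρ β (κ := Real.exp (-β * (N * Fintype.card (Plaquette d L))) * (N : ℝ)⁻¹)
    (by positivity) (hgm b) (hgm (a + 1)) (hgb b) (hgb (a + 1)) (hgd b hb1 hb) (hgd (a + 1) (by omega) ha)
    (wilsonLoop ρ ((0 : Site d L) + Pi.single 0 (((L / 2 + 1 : ℕ)) : ZMod L) +
      Pi.single 0 (-((b : ℕ) : ZMod L))) 0 j (b + (a + 1)) m)
    (wilsonLoop ρ ((0 : Site d L) + Pi.single 0 (((L / 2 + 1 : ℕ)) : ZMod L) +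
      Pi.single 0 (-((b : ℕ) : ZMod L))) 0 j (b + b) m)
    (wilsonLoop ρ ((0 : Site d L) + Pi.single 0 (((L / 2 + 1 : ℕ)) : ZMod L) +
      Pi.single 0 (-(((a + 1 : ℕ)) : ZMod L))) 0 j ((a + 1) + (a + 1)) m)
    (measurable_wilsonLoop ρ hρ _ _ _ _ _) (measurable_wilsonLoop ρ hρ _ _ _ _ _)
    (measurable_wilsonLoop ρ hρ _ _ _ _ _) (by
      intro ΦΨ hmem U Y
      simp only [List.mem_cons, List.mem_nil_iff, or_false] at hmem
      rcases hmem with rfl | rfl | rfl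
      · exact weight_mul_wilsonLoop_site_odd ρ hL hρ hβ hj hb ha m U Y
      · exact hbb U Y
      · exact weight_mul_wilsonLoop_site_odd ρ hL hρ hβ hj ha ha m U Y)
  obtain ⟨h0, hsq⟩ := hI
  rw [← wilsonExpectation_wilsonLoop_eq_zero_base ρ β ((0 : Site d L) +
      Pi.single 0 (((L / 2 + 1 : ℕ)) : ZMod L) + Pi.single 0 (-((b : ℕ) : ZMod L))) 0 j (b + (a + 1)),
    ← wilsonExpectation_wilsonLoop_eq_zero_base ρ β ((0 : Site d L) +
      Pi.single 0 (((L / 2 + 1 : ℕ)) : ZMod L) + Pi.single 0 (-((b : ℕ) : ZMod L))) 0 j (b + b),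
    ← wilsonExpectation_wilsonLoop_eq_zero_base ρ β ((0 : Site d L) +
      Pi.single 0 (((L / 2 + 1 : ℕ)) : ZMod L) + Pi.single 0 (-(((a + 1 : ℕ)) : ZMod L))) 0 j
      ((a + 1) + (a + 1)),
    wilsonExpectation_real_eq_toReal_mul_integral ρ hρ, wilsonExpectation_real_eq_toReal_mul_integral ρ hρ,
    wilsonExpectation_real_eq_toReal_mul_integral ρ hρ]
  refine ⟨mul_nonneg ENNReal.toReal_nonneg h0, ?_⟩
  rw [mul_pow, mul_mul_mul_comm, ← sq]
  exact mul_le_mul_of_nonneg_left hsq (sq_nonneg _)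

end Main

end StringTension

end Literature.MathematicalPhysics.QuantumFieldTheory
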